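import Mathlib
import Literature.ModelTheory.ExponentialFields.SemialgebraicInterior

/-!
# Crux `TateFamilyKernel` (stmt-KontsevichZagierPeriods-9130), line `Sketch`: `stub_linDensity`

Step 2 (PUSHFORWARD DENSITY) of the linear class `Q = 1 − ϖ(α + βz₂)z₁`, `P` `ϖ`-free
(`0 < α`, `0 < β`), in the lead's skeleton for the crux
`Summit.KontsevichZagierPeriods.KontsevichZagierPeriods.Theses.InverseLandau.TateFamilyKernel`.

Write `T(z) = (α + βz₂)z₁ : (0,1)² → (0, α+β)`, `w(s) = α + βs` and
`Ψ(y,s) = P(y/w(s), s)/w(s)`.  If all moments `∫_{(0,1)²} P(z) T(z)^M dz` vanish, then the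
pushforward of the signed measure `P dz` under `T` is zero; its density is
`Φ(y) = ∫_{s ∈ (0,1), w(s) > y} Ψ(y,s) ds = ∫_{max(0,(y−α)/β)}^{1} Ψ(y,s) ds`, and for
`y ∈ (α, α+β)` the `s`-domain is exactly `((y−α)/β, 1)`.  Proof, all in Mathlib's measure theory:

1. transport the square integral to `ℝ × ℝ` (`MeasurableEquiv.finTwoArrow`,
   `MeasureTheory.volume_preserving_finTwoArrow`) and write it as an iterated integral with
   `s = z₂` outside (`MeasureTheory.integral_prod_symm`);
2. at fixed `s ∈ (0,1)` substitute `y = w(s)·z₁` in the inner integral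
   (`intervalIntegral.inv_smul_integral_comp_div`) and extend the integrand by zero to
   `y ∈ (0, α+β)` (an indicator of the measurable region `{y < w(s)}`);
3. swap the order of integration (`MeasureTheory.integral_integral_swap`; the integrand is an
   indicator times a continuous function on a bounded rectangle, hence integrable) and identify
   the inner `s`-integral with `Φ(y)·y^M`, so `∫_0^{α+β} Φ(y) y^M dy = 0` for all `M`;
4. `Φ` is continuous (`intervalIntegral.continuous_parametric_intervalIntegral_of_continuous`
   with the continuously moving endpoint `max(0,(y−α)/β)`; the weight is regularised to
   `w(s) = α + β·max(s,0) ≥ α > 0` so that `Ψ` is continuous on all of `ℝ²`, which changes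
   nothing on `s ≥ 0`), hence orthogonal to all polynomials, hence (Weierstrass,
   `exists_polynomial_near_of_continuousOn`) `∫_0^{α+β} Φ² = 0`, hence `Φ ≡ 0` on `(0, α+β)`
   (`intervalIntegral.integral_pos_iff_support_of_nonneg_ae` and positivity of Lebesgue measure
   on non-empty open sets).

References: Kontsevich–Zagier 2001, §1.2 (the period conjecture; this is an elementary
real-analysis step of one of its test classes).  Mathlib plus the continuity of polynomial
functions `Literature.ModelTheory.ExponentialFields.continuous_aeval_real`; no named fact, no new
definition.  Helpers live in the sub-namespace `LinDensity`.
-/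

noncomputable section

open MeasureTheory Set MvPolynomial
open Literature.ModelTheory.ExponentialFields (continuous_aeval_real)

namespace Summit.KontsevichZagierPeriods.InverseLandau.TateFamilyKernel.Descent

namespace LinDensity

/-! ### Weierstrass: a continuous function with vanishing moments on `[0, L]` is zero on `(0, L)` -/

/-- If all moments `∫_0^L Φ(y) y^M dy` of a continuous `Φ` vanish, then `∫_0^L Φ·p = 0` for
every real polynomial `p` (linearity). [folklore] -/
theorem intervalIntegral_mul_polynomial_eq_zero {L : ℝ} {Φ : ℝ → ℝ} (hΦ : Continuous Φ)
    (hmom : ∀ M : ℕ, ∫ y in 0..L, Φ y * y ^ M = 0) (p : Polynomial ℝ) :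
    ∫ y in 0..L, Φ y * p.eval y = 0 := by
  refine p.induction_on' (fun p q hp hq => ?_) (fun n c => ?_)
  · simp only [Polynomial.eval_add, mul_add]
    rw [intervalIntegral.integral_add, hp, hq, add_zero]
    · exact (hΦ.mul p.continuous).intervalIntegrable _ _
    · exact (hΦ.mul q.continuous).intervalIntegrable _ _
  · simp only [Polynomial.eval_monomial]
    rw [show (fun y => Φ y * (c * y ^ n)) = fun y => c * (Φ y * y ^ n) from
      funext fun y => by ring, intervalIntegral.integral_const_mul, hmom n, mul_zero]

/-- If all moments `∫_0^L Φ(y) y^M dy` (`0 ≤ L`) of a continuous `Φ` vanish, then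
`∫_0^L Φ² = 0`: approximate `Φ` uniformly on `[0, L]` by polynomials `p` (Weierstrass,
`exists_polynomial_near_of_continuousOn`); `∫ Φ² = ∫ Φ(Φ − p)` is arbitrarily small. [folklore] -/
theorem intervalIntegral_mul_self_eq_zero {L : ℝ} (hL : 0 ≤ L) {Φ : ℝ → ℝ} (hΦ : Continuous Φ)
    (hmom : ∀ M : ℕ, ∫ y in 0..L, Φ y * y ^ M = 0) :
    ∫ y in 0..L, Φ y * Φ y = 0 := by
  obtain ⟨C, hC⟩ := (isCompact_Icc : IsCompact (Icc (0 : ℝ) L)).exists_bound_of_continuousOn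
    hΦ.continuousOn
  have hC0 : 0 ≤ C := (norm_nonneg _).trans (hC 0 (left_mem_Icc.2 hL))
  have hCL : 0 < C * L + 1 := add_pos_of_nonneg_of_pos (mul_nonneg hC0 hL) one_pos
  have key : ∀ δ : ℝ, 0 < δ → |∫ y in 0..L, Φ y * Φ y| ≤ δ := by
    intro δ hδ
    obtain ⟨p, hp⟩ := exists_polynomial_near_of_continuousOn 0 L Φ hΦ.continuousOn
      (δ / (C * L + 1)) (div_pos hδ hCL)
    have hsplit : ∫ y in 0..L, Φ y * Φ y = ∫ y in 0..L, Φ y * (Φ y - p.eval y) := by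
      rw [show (fun y => Φ y * Φ y) = fun y => Φ y * (Φ y - p.eval y) + Φ y * p.eval y from
        funext fun y => by ring, intervalIntegral.integral_add,
        intervalIntegral_mul_polynomial_eq_zero hΦ hmom p, add_zero]
      · exact (hΦ.mul (hΦ.sub p.continuous)).intervalIntegrable _ _
      · exact (hΦ.mul p.continuous).intervalIntegrable _ _
    have hbound : ∀ y ∈ Set.uIoc 0 L, ‖Φ y * (Φ y - p.eval y)‖ ≤ C * (δ / (C * L + 1)) := by
      intro y hy
      rw [uIoc_of_le hL] at hy
      have hy' : y ∈ Icc 0 L := Ioc_subset_Icc_self hy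
      rw [norm_mul]
      refine mul_le_mul (hC y hy') ?_ (norm_nonneg _) hC0
      rw [Real.norm_eq_abs, abs_sub_comm]
      exact (hp y hy').le
    rw [hsplit]
    calc |∫ y in 0..L, Φ y * (Φ y - p.eval y)|
        = ‖∫ y in 0..L, Φ y * (Φ y - p.eval y)‖ := (Real.norm_eq_abs _).symm
      _ ≤ C * (δ / (C * L + 1)) * |L - 0| :=
          intervalIntegral.norm_integral_le_of_norm_le_const hbound
      _ = δ * (C * L / (C * L + 1)) := by rw [sub_zero, abs_of_nonneg hL]; ring
      _ ≤ δ * 1 := by gcongr; rw [div_le_one hCL]; linarith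
      _ = δ := mul_one δ
  exact abs_nonpos_iff.1 (le_of_forall_pos_le_add fun δ hδ => by rw [zero_add]; exact key δ hδ)

/-- **Vanishing moments force vanishing.** A continuous `Φ : ℝ → ℝ` all of whose moments
`∫_0^L Φ(y) y^M dy` vanish is zero on `(0, L)`: `∫_0^L Φ² = 0`
(`intervalIntegral_mul_self_eq_zero`), and a continuous non-negative function with zero integral
has a Lebesgue-null, hence empty, open support in `(0, L)`. [folklore] -/
theorem eq_zero_of_forall_moment_eq_zero {L : ℝ} {Φ : ℝ → ℝ} (hΦ : Continuous Φ)
    (hmom : ∀ M : ℕ, ∫ y in 0..L, Φ y * y ^ M = 0) {y : ℝ} (hy : y ∈ Ioo 0 L) : Φ y = 0 := by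
  have hL : 0 < L := hy.1.trans hy.2
  by_contra hne
  have hpos : 0 < ∫ x in 0..L, Φ x * Φ x := by
    rw [intervalIntegral.integral_pos_iff_support_of_nonneg_ae
      (Filter.Eventually.of_forall fun x => mul_self_nonneg (Φ x))
      ((hΦ.mul hΦ).intervalIntegrable 0 L)]
    refine ⟨hL, ?_⟩
    have hopen : IsOpen (Function.support (fun x => Φ x * Φ x) ∩ Ioo 0 L) :=
      (hΦ.mul hΦ).isOpen_support.inter isOpen_Ioo
    have hne' : (Function.support (fun x => Φ x * Φ x) ∩ Ioo 0 L).Nonempty :=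
      ⟨y, Function.mem_support.2 (mul_self_ne_zero.2 hne), hy⟩
    exact (hopen.measure_pos volume hne').trans_le
      (measure_mono (Set.inter_subset_inter_right _ Ioo_subset_Ioc_self))
  exact hpos.ne' (intervalIntegral_mul_self_eq_zero hL.le hΦ hmom)

/-! ### Plane integrals: transport, Fubini, substitution -/

/-- The vector `![f x, g x] : Fin 2 → ℝ` depends continuously on `x` if `f` and `g` do.
[folklore] -/
theorem continuous_vec_two {X : Type*} [TopologicalSpace X] {f g : X → ℝ} (hf : Continuous f)
    (hg : Continuous g) : Continuous fun x => (![f x, g x] : Fin 2 → ℝ) :=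
  continuous_pi fun i => by
    fin_cases i
    · simpa using hf
    · simpa using hg

/-- The density integrand `Ψ(y,s) = P(y/w(s), s)/w(s)` is jointly continuous when the weight `w`
is continuous and never zero. [folklore] -/
theorem continuous_densityIntegrand (P : MvPolynomial (Fin 2) ℚ) {w : ℝ → ℝ} (hw : Continuous w)
    (hw0 : ∀ s, w s ≠ 0) :
    Continuous (Function.uncurry fun y s : ℝ => aeval ![y / w s, s] P / w s) := by
  have h1 : Continuous fun p : ℝ × ℝ => w p.2 := hw.comp continuous_snd
  exact ((continuous_aeval_real P).comp
    (continuous_vec_two (continuous_fst.div h1 fun p => hw0 p.2) continuous_snd)).div h1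
    fun p => hw0 p.2

/-- Transport of the integral over the open unit square `(0,1)² ⊆ ℝ^{Fin 2}` to the product
`(0,1) ×ˢ (0,1) ⊆ ℝ × ℝ` along the volume-preserving `MeasurableEquiv.finTwoArrow`, for an
arbitrary integrand. [folklore] -/
theorem setIntegral_pi_Ioo_fin_two (g : (Fin 2 → ℝ) → ℝ) :
    ∫ z in Set.pi Set.univ (fun _ : Fin 2 => Ioo (0 : ℝ) 1), g z =
      ∫ p in Ioo (0 : ℝ) 1 ×ˢ Ioo (0 : ℝ) 1, g ![p.1, p.2] := by
  have hmp : MeasurePreserving (MeasurableEquiv.finTwoArrow (α := ℝ)).symm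
      (volume : Measure (ℝ × ℝ)) (volume : Measure (Fin 2 → ℝ)) :=
    (volume_preserving_finTwoArrow ℝ).symm _
  have happ : ∀ p : ℝ × ℝ, (MeasurableEquiv.finTwoArrow (α := ℝ)).symm p = ![p.1, p.2] :=
    fun p => by ext i; fin_cases i <;> rfl
  have hpre : (MeasurableEquiv.finTwoArrow (α := ℝ)).symm ⁻¹'
      (Set.pi Set.univ fun _ : Fin 2 => Ioo (0 : ℝ) 1) = Ioo 0 1 ×ˢ Ioo 0 1 := by
    ext p
    simp [Fin.forall_fin_two, mem_prod]
  rw [← hmp.setIntegral_preimage_emb (MeasurableEquiv.measurableEmbedding _) g, hpre]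
  simp_rw [happ]

/-- Fubini on the open unit square for a continuous integrand, second coordinate outside:
`∫_{(0,1)×(0,1)} G = ∫_{s ∈ (0,1)} ∫_{x ∈ (0,1)} G(x,s)`. [folklore] -/
theorem setIntegral_Ioo_prod_Ioo_symm (G : ℝ × ℝ → ℝ) (hG : Continuous G) :
    ∫ p in Ioo (0 : ℝ) 1 ×ˢ Ioo (0 : ℝ) 1, G p =
      ∫ s in Ioo (0 : ℝ) 1, ∫ x in Ioo (0 : ℝ) 1, G (x, s) := by
  have hK : IsCompact (Icc (0 : ℝ) 1 ×ˢ Icc (0 : ℝ) 1) := isCompact_Icc.prod isCompact_Icc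
  have hint : IntegrableOn G (Ioo (0 : ℝ) 1 ×ˢ Ioo (0 : ℝ) 1) volume :=
    (hG.continuousOn.integrableOn_compact hK).mono_set
      (Set.prod_mono Ioo_subset_Icc_self Ioo_subset_Icc_self)
  rw [Measure.volume_eq_prod, ← Measure.prod_restrict]
  refine integral_prod_symm G ?_
  rw [Measure.prod_restrict, ← Measure.volume_eq_prod]
  exact hint

/-- Fubini for set integrals on `ℝ × ℝ`: the two iterated integrals over `S ×ˢ T` of an
integrand integrable on `S ×ˢ T` agree. [folklore] -/
theorem setIntegral_setIntegral_swap (F : ℝ × ℝ → ℝ) {S T : Set ℝ}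
    (hF : IntegrableOn F (S ×ˢ T) volume) :
    ∫ s in S, ∫ y in T, F (s, y) = ∫ y in T, ∫ s in S, F (s, y) := by
  apply integral_integral_swap
  rw [Measure.prod_restrict, ← Measure.volume_eq_prod]
  exact hF

/-- The linear substitution `y = c·x` (`0 < c ≤ L`) in an integral over `(0,1)`, with the new
integrand extended by zero from `(0,c)` to `(0,L)`:
`∫_{(0,1)} f = ∫_{y ∈ (0,L)} 𝟙_{y<c} c⁻¹ f(y/c)`; no hypothesis on `f`. [folklore] -/
theorem setIntegral_Ioo_unit_substitution (f : ℝ → ℝ) {c L : ℝ} (hc : 0 < c) (hcL : c ≤ L) :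
    ∫ x in Ioo (0 : ℝ) 1, f x =
      ∫ y in Ioo (0 : ℝ) L, (Iio c).indicator (fun y => c⁻¹ * f (y / c)) y := by
  calc ∫ x in Ioo (0 : ℝ) 1, f x
      = ∫ x in (0 : ℝ)..1, f x := by
        rw [intervalIntegral.integral_of_le zero_le_one, integral_Ioc_eq_integral_Ioo]
    _ = c⁻¹ * ∫ y in (0 : ℝ)..c, f (y / c) := by
        rw [← smul_eq_mul, intervalIntegral.inv_smul_integral_comp_div, zero_div, div_self hc.ne']
    _ = ∫ y in (0 : ℝ)..c, c⁻¹ * f (y / c) := by rw [intervalIntegral.integral_const_mul]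
    _ = ∫ y in Ioo 0 c, c⁻¹ * f (y / c) := by
        rw [intervalIntegral.integral_of_le hc.le, integral_Ioc_eq_integral_Ioo]
    _ = ∫ y in Ioo (0 : ℝ) L, (Iio c).indicator (fun y => c⁻¹ * f (y / c)) y := by
        rw [setIntegral_indicator measurableSet_Iio, Ioo_inter_Iio, min_eq_right hcL]

/-- The `s`-section of the region `{y < w(s)}` inside `(0,1)`, for a weight with `w(s) = a + b s`
on `s > 0` (`0 < b`) and a level `y < a + b`, is the interval `(max(0,(y−a)/b), 1)`:
`∫_{s ∈ (0,1)} 𝟙_{y < w(s)} h(s) = ∫_{max(0,(y−a)/b)}^{1} h`. [folklore] -/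
theorem setIntegral_Ioo_indicator_lt {a b : ℝ} (hb : 0 < b) {w : ℝ → ℝ} (hw : Measurable w)
    (hws : ∀ s, 0 < s → w s = a + b * s) {y : ℝ} (hy : y < a + b) (h : ℝ → ℝ) :
    ∫ s in Ioo (0 : ℝ) 1, {s | y < w s}.indicator h s = ∫ s in max 0 ((y - a) / b)..1, h s := by
  rw [setIntegral_indicator (measurableSet_lt measurable_const hw)]
  have hset : Ioo (0 : ℝ) 1 ∩ {s | y < w s} = Ioo (max 0 ((y - a) / b)) 1 := by
    ext s
    simp only [mem_inter_iff, mem_Ioo, mem_setOf_eq, max_lt_iff]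
    constructor
    · rintro ⟨⟨h0, h1⟩, hy'⟩
      rw [hws s h0] at hy'
      exact ⟨⟨h0, by rw [div_lt_iff₀ hb]; linarith⟩, h1⟩
    · rintro ⟨⟨h0, hy'⟩, h1⟩
      refine ⟨⟨h0, h1⟩, ?_⟩
      rw [hws s h0]
      rw [div_lt_iff₀ hb] at hy'
      linarith
  have hm1 : max 0 ((y - a) / b) ≤ 1 :=
    max_le zero_le_one (by rw [div_le_one hb]; linarith)
  rw [hset, intervalIntegral.integral_of_le hm1, integral_Ioc_eq_integral_Ioo]

/-- A parametric interval integral `y ↦ ∫_{m(y)}^{1} ψ(y,s) ds` with jointly continuous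
integrand and continuously moving lower endpoint is continuous
(`intervalIntegral.continuous_parametric_intervalIntegral_of_continuous`). [folklore] -/
theorem continuous_parametric_intervalIntegral_left {ψ : ℝ → ℝ → ℝ}
    (hψ : Continuous (Function.uncurry ψ)) {m : ℝ → ℝ} (hm : Continuous m) :
    Continuous fun y => ∫ s in m y..1, ψ y s := by
  have h : Continuous fun y => ∫ s in (1 : ℝ)..m y, ψ y s :=
    intervalIntegral.continuous_parametric_intervalIntegral_of_continuous hψ hm
  have h' : (fun y => ∫ s in m y..1, ψ y s) = fun y => -∫ s in (1 : ℝ)..m y, ψ y s := by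
    funext y
    exact intervalIntegral.integral_symm 1 (m y)
  rw [h']
  exact h.neg

end LinDensity

open LinDensity in
/-- **Stub `stub_linDensity`** (linear class `Q = 1 − ϖ(α + βz₂)z₁`, `P` `ϖ`-free, step 2:
PUSHFORWARD DENSITY).  If all moments `∫_{(0,1)²} P(z)·((α + βz₂)z₁)^M dz` vanish
(`0 < α`, `0 < β`), then for every `y ∈ (α, α+β)`,
`∫_{(y−α)/β}^{1} P(y/(α+βs), s)/(α+βs) ds = 0`.  Indeed the density
`Φ(y) = ∫_{max(0,(y−α)/β)}^{1} P(y/(α+βs), s)/(α+βs) ds` of the pushforward of `P dz` under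
`T = (α+βz₂)z₁` (substitute `y = (α+βs)z₁` at fixed `s`, then Fubini over `{0 < y < α+βs}`)
is continuous on `[0, α+β]` with moments `∫_0^{α+β} Φ(y) y^M dy = ∫ P·T^M = 0`, hence zero on
`(0, α+β)` by Weierstrass (`eq_zero_of_forall_moment_eq_zero`); on `(α, α+β)` the `s`-domain is
`((y−α)/β, 1)`. [cite: KontsevichZagier2001, §1.2] -/
theorem stub_linDensity (α β : ℚ) (P : MvPolynomial (Fin 2) ℚ) (hα : 0 < α) (hβ : 0 < β)
    (hmom : ∀ M : ℕ, ∫ z in Set.pi Set.univ (fun _ : Fin 2 => Ioo (0 : ℝ) 1),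
      aeval z P * (((α : ℝ) + β * z 1) * z 0) ^ M = 0) :
    ∀ y ∈ Ioo (α : ℝ) (α + β), ∫ s in Ioo ((y - α) / β) 1,
      aeval ![y / ((α : ℝ) + β * s), s] P / ((α : ℝ) + β * s) = 0 := by
  have ha : (0 : ℝ) < α := by exact_mod_cast hα
  have hb : (0 : ℝ) < β := by exact_mod_cast hβ
  set a : ℝ := (α : ℝ) with ha_def
  set b : ℝ := (β : ℝ) with hb_def
  -- the regularised weight `w s = a + b·max(s,0)` (`= a + b s` for `s ≥ 0`), continuous and `> 0`
  obtain ⟨w, hw_def⟩ : ∃ w : ℝ → ℝ, w = fun s => a + b * max s 0 := ⟨_, rfl⟩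
  have hw_cont : Continuous w := by rw [hw_def]; fun_prop
  have hw_pos : ∀ s, 0 < w s := fun s => by
    rw [hw_def]
    exact add_pos_of_pos_of_nonneg ha (mul_nonneg hb.le (le_max_right _ _))
  have hws : ∀ s, 0 < s → w s = a + b * s := fun s hs => by
    rw [hw_def]
    show a + b * max s 0 = a + b * s
    rw [max_eq_left hs.le]
  -- the density integrand `ψ` and the density `Φ` of `T_*(P dz)`
  obtain ⟨ψ, hψ_def⟩ : ∃ ψ : ℝ → ℝ → ℝ, ψ = fun y s => aeval ![y / w s, s] P / w s := ⟨_, rfl⟩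
  have hψ_cont : Continuous (Function.uncurry ψ) := by
    rw [hψ_def]
    exact continuous_densityIntegrand P hw_cont fun s => (hw_pos s).ne'
  obtain ⟨Φ, hΦ_def⟩ : ∃ Φ : ℝ → ℝ, Φ = fun y => ∫ s in max 0 ((y - a) / b)..1, ψ y s := ⟨_, rfl⟩
  have hΦ_cont : Continuous Φ := by
    rw [hΦ_def]
    exact continuous_parametric_intervalIntegral_left hψ_cont (by fun_prop)
  -- the moments of `Φ` on `[0, a + b]` are the moments `∫_□ P · T^M`, hence zero
  have hΦmom : ∀ M : ℕ, ∫ y in 0..(a + b), Φ y * y ^ M = 0 := by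
    intro M
    -- (i) the square integral as an iterated integral, `s = z 1` outside
    have h1 : ∫ s in Ioo (0 : ℝ) 1, ∫ x in Ioo (0 : ℝ) 1,
        aeval ![x, s] P * ((a + b * s) * x) ^ M = 0 := by
      have h := hmom M
      rw [setIntegral_pi_Ioo_fin_two] at h
      simp only [Matrix.cons_val_zero, Matrix.cons_val_one] at h
      have hGc : Continuous fun p : ℝ × ℝ => aeval ![p.1, p.2] P * ((a + b * p.2) * p.1) ^ M :=
        ((continuous_aeval_real P).comp
          (continuous_vec_two continuous_fst continuous_snd)).mul (by fun_prop)
      rwa [setIntegral_Ioo_prod_Ioo_symm _ hGc] at h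
    -- the integrand after the substitution `y = (a + b s) x` and zero-extension in `y`
    obtain ⟨F, hF_def⟩ : ∃ F : ℝ × ℝ → ℝ,
        F = {p : ℝ × ℝ | p.2 < w p.1}.indicator (fun p => ψ p.2 p.1 * p.2 ^ M) := ⟨_, rfl⟩
    -- (ii) substitution in the inner integral
    have h2 : ∫ s in Ioo (0 : ℝ) 1, ∫ y in Ioo 0 (a + b), F (s, y) = 0 := by
      refine Eq.trans ?_ h1
      refine setIntegral_congr_fun measurableSet_Ioo fun s hs => ?_
      have hc : 0 < a + b * s := add_pos ha (mul_pos hb hs.1)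
      have hcL : a + b * s ≤ a + b := by nlinarith [hs.2]
      rw [setIntegral_Ioo_unit_substitution (fun x => aeval ![x, s] P * ((a + b * s) * x) ^ M)
        hc hcL]
      refine setIntegral_congr_fun measurableSet_Ioo fun y _ => ?_
      simp only [hF_def, hψ_def, Set.indicator_apply, Set.mem_Iio, Set.mem_setOf_eq, hws s hs.1]
      split_ifs
      · rw [mul_div_cancel₀ y hc.ne']
        ring
      · rfl
    -- (iii) Fubini
    have hF_int : IntegrableOn F (Ioo (0 : ℝ) 1 ×ˢ Ioo 0 (a + b)) volume := by
      rw [hF_def]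
      refine Integrable.indicator ?_
        (measurableSet_lt measurable_snd (hw_cont.measurable.comp measurable_fst))
      have hGc : Continuous fun p : ℝ × ℝ => ψ p.2 p.1 * p.2 ^ M :=
        (hψ_cont.comp (continuous_snd.prodMk continuous_fst)).mul (continuous_snd.pow M)
      have hK : IsCompact (Icc (0 : ℝ) 1 ×ˢ Icc 0 (a + b)) := isCompact_Icc.prod isCompact_Icc
      exact (hGc.continuousOn.integrableOn_compact hK).mono_set
        (Set.prod_mono Ioo_subset_Icc_self Ioo_subset_Icc_self)
    have h3 : ∫ y in Ioo 0 (a + b), ∫ s in Ioo (0 : ℝ) 1, F (s, y) = 0 := by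
      rw [← setIntegral_setIntegral_swap F hF_int]
      exact h2
    -- (iv) the inner integral is `Φ y · y ^ M`
    have h4 : ∫ y in Ioo 0 (a + b), Φ y * y ^ M = 0 := by
      refine Eq.trans ?_ h3
      refine setIntegral_congr_fun measurableSet_Ioo fun y hy => ?_
      have hind : ∀ s, F (s, y) = {s | y < w s}.indicator (fun s => ψ y s * y ^ M) s := by
        intro s
        simp only [hF_def, Set.indicator_apply, Set.mem_setOf_eq]
      simp_rw [hind]
      rw [setIntegral_Ioo_indicator_lt hb hw_cont.measurable hws hy.2,
        intervalIntegral.integral_mul_const, hΦ_def]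
    rw [intervalIntegral.integral_of_le (add_pos ha hb).le, integral_Ioc_eq_integral_Ioo]
    exact h4
  -- Weierstrass: `Φ` vanishes on `(0, a + b)`, in particular at `y ∈ (a, a + b)`
  intro y hy
  have hΦy : Φ y = 0 := eq_zero_of_forall_moment_eq_zero hΦ_cont hΦmom ⟨ha.trans hy.1, hy.2⟩
  have hm0 : 0 < (y - a) / b := div_pos (sub_pos.2 hy.1) hb
  have hm1 : (y - a) / b ≤ 1 := by rw [div_le_one hb]; linarith [hy.2]
  rw [hΦ_def] at hΦy
  simp only at hΦy
  rw [max_eq_right hm0.le, intervalIntegral.integral_of_le hm1, integral_Ioc_eq_integral_Ioo] at hΦy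
  rw [← hΦy]
  refine setIntegral_congr_fun measurableSet_Ioo fun s hs => ?_
  simp only [hψ_def, hws s (hm0.trans hs.1)]

end Summit.KontsevichZagierPeriods.InverseLandau.TateFamilyKernel.Descent

end
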